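import Literature.Computability.AlgebraicComplexity.DDS21TranscriptResidues
import Literature.Computability.AlgebraicComplexity.DDS21DiDILCompanion
import Literature.Computability.AlgebraicComplexity.DDS21DiDILEndGame
import Literature.Computability.AlgebraicComplexity.DDS21CertTowerBudget
import Literature.Computability.AlgebraicComplexity.DDS21TopFaninTwoABP
import Literature.Computability.AlgebraicComplexity.DDS21SliceZeroPrograms
import HarnessLib

/-!
# DDS21 Thm. 3.2 (de-bordering `Σ^{[k]}ΠΣ`): the residue chain EXISTS — the producers' side
# composed at the generic point (stage 0, the regular run, divisor pairs, the end pair), and the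
# whole chain modulo the Claim-3.8 slice programs

Theorem-only file (cell `val-lit`, np lane, DDS21 Thm 3.2 programme "M-b", lead-np RULING (164)(b):
owner of `residueChain_exists`, the ONE `F′(x)`-side hypothesis of
`DDS2021_thm_3_2_of_residueChain` (`DDS21TranscriptInstantiation.lean`, p1 g10)). Source:
P. Dutta, P. Dwivedi, N. Saxena, *Demystifying the border of depth-3 algebraic circuits*, FOCS 2021,
full version `paper:galaxy-pdf-7641649743695546420` (chunk `pNNNN.txt`, printed line `Lnnn`), §3
proof of Thm. 3.2 (p0028 L745 – p0036 L964) [DuttaDwivediSaxena2022].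

Architecture of record (A′): for `f ∈ \overline{Σ^{[k]}Π^{[d]}Σ}` over `F` the DiDIL induction is
run over `F′ ⊇ F[y]` (a fraction field of `F[y_1,…,y_n]`; of record `F′ = Frac F[y]`) on the input
read over `F′` and SHIFTED by the generic point `y` ("`α_i` random", p0028 L751–754). This file
COMPOSES the landed bricks, by name:
`DDS21TranscriptResidues.lean` (stage-0 glue `exists_shiftedForms`, the run `exists_didil_run`,
`run_invariant_termwise`), `DDS21StageZeroRegularForms.lean` (`hreg_of_generic_shift`: the shifted
forms are `ε`-regular), `DDS21DiDILStep.lean` (`exists_stageZero_ofLiveTerm`, `formsSat_didilStep`),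
`DDS21DiDILCompanion.lean` (`stageComp_zero_of_ofLiveTerm`, `stageComp_run`,
`exists_divisor_limit_ldeg`, `ldeg_add_eq_of_cross`: the companion invariant and the graded
valuation `[j ≥ 1]` of the divisors), `DDS21SliceZeroPrograms.lean` (`uniformQ_run`,
`exists_sliceZero_programs_le`: the Claim-3.8 slice programs), `DDS21DiDILEndGame.lean`
(`ExactTerm.uabp_residue_scaled_le_of_formsSat`: limits of regular exact terms are ratios
`N₀/D₀` of ABP-computed polynomials within `S^10`).

## Contents of Part 1 (all PROVED; 0 definitions, 0 named facts)

* ★ `exists_stageZero_generic`: STAGE 0 AT THE GENERIC POINT — from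
  `f ∈ \overline{Σ^{[k]}Π^{[d]}Σ}` over `F`: `m ≤ k` well-formed, nondegenerate exact terms over
  `F′(ε)` of size `≤ d` with trivial certificates, `ε`-REGULAR form lists (`FormsSat`), the
  COMPANION invariant with excess `0` (`StageComp`), and `lim Σ_i T_i = f^φ(x + y)` in `F′(x)`.
* ★ `exists_regular_run`: THE REGULAR RUN — `exists_didil_run` from that stage with the two
  invariants carried to every stage (`run_invariant_termwise` / `stageComp_run`): every term of
  every stage has `ε`-regular form lists, and stage `j` has the companion invariant with excess
  `min j 1`; the term count `(Fam j).1 + j = m ≤ k` (one term consumed per round); and the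
  uniform `𝒬`-record at every stage (`uniformQ_run`).
* ★ `round_pair`: ONE ROUND'S DIVISOR PAIR — for a nondegenerate divisor `T_{i₀} = c·U`,
  `lim U = u ≠ 0`, of a certified regular companion stage with excess `e` and sizes within one
  parameter `S`: `u = tn/td` with `tn, td ≠ 0`, `ldeg tn = ldeg td + e`, programs and degrees
  within `S^10` (E3 on the divisor term + E4.4's graded valuation, transported to E3's pair by
  cross-multiplication).
* `end_pair`, `end_pair_zero`: THE END PAIR — the last scaled term's limit (or `0`) is `N₀/D₀`
  with programs and degrees within `S^10`.

## Contents of Part 2 (all PROVED; 0 definitions, 0 named facts)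

* ★★ `exists_residueChain_of_slice`: THE RESIDUE CHAIN, COMPOSED (per instance, general `F′`):
  from the run, the divisor pairs, the end pair, the budget towers of `DDS21CertTowerBudget.lean`
  (`run_towers_le`, `certDegree_le`, `transcriptBudget`; certificate degree `N := 20^(k−1)·d + 1`,
  stage parameter `S := s^(90·7^(k−1))`) and the Claim-3.8 slice programs
  `exists_sliceZero_programs_le` of `DDS21SliceZeroPrograms.lean` (t21 g13): residues, chain
  equations, divisor pairs with the `ldeg` clause, Claim-3.8 pairs, end pair, programs/degrees
  within `S^25`.
* ★★★ `residueChain_exists`: over the field of record `F′ = Frac F[y]`, the hypothesis of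
  `DDS2021_thm_3_2_of_residueChain` — binder VERBATIM — with `σ := S^25`, `c₀ := 15757`
  (`succ_pow_le_stagePow`). The one-liner `DDS2021_thm_3_2_holds` is p1's
  `AC/DDS21Thm32Holds.lean` (lead-np RULING (164)(e)). Honest framing: composition of
KNOWN results; `DDS2021_thm_3_2` stays OPEN by name until `DDS2021_thm_3_2_holds` is filed;
VP ≠ VNP is NOT proved and nothing here bears on it.

## References

* [DuttaDwivediSaxena2022] P. Dutta, P. Dwivedi, N. Saxena, *Demystifying the border of depth-3
  algebraic circuits*, Proc. 62nd FOCS (2021), IEEE 2022, 92–103; full version §3 proof of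
  Thm. 3.2: base case p0028 L745–757, induction p0030 L797–812, Claims 3.3–3.6 (p0027 L724–744,
  p0029 L772 – p0033 L890), end of the induction p0033 L891 – p0034 L897.
-/

noncomputable section

open MvPolynomial
open scoped BigOperators Polynomial

namespace Literature.Computability.AlgebraicComplexity

namespace DDS2021

section Generic

variable {F : Type*} [Field F] {n : ℕ} {F' : Type*} [Field F']
  [Algebra (MvPolynomial (Fin n) F) F'] [IsFractionRing (MvPolynomial (Fin n) F) F']
  [Algebra F F'] [IsScalarTower F (MvPolynomial (Fin n) F) F']

/-! ## §A Stage 0 at the generic point -/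

/-- ★ **Stage 0 at the generic point.** For `f ∈ \overline{Σ^{[k]}Π^{[d]}Σ}` over `F` and a fraction
field `F′` of `F[y_1,…,y_n]`: the input read over `F′` and shifted by `y` is the limit, in `F′(x)`, of
the value sum of `m ≤ k` well-formed nondegenerate exact terms over `F′(ε)` of size `≤ d` with
trivial `Σ∧Σ` certificates (B4b `exists_stageZero_ofLiveTerm`), whose form lists are `ε`-REGULAR
(`hreg_of_generic_shift`) and which carry the companion invariant with excess `0`
(`stageComp_zero_of_ofLiveTerm`, `isPres_affForm_shift`) and a UNIFORM `𝒬`-record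
(`uniformQ_of_ofLiveTerm`, `DDS21SliceZeroPrograms.lean`).
[cite: DuttaDwivediSaxena2022, §3 proof of Thm. 3.2, base case "`Φ : x_i ↦ z·x_i + α_i` … `Ψ(T_{i,0})|_{x=0} = T_{i,0}(α) ≠ 0`" (full version p0028 L745–757)] -/
theorem exists_stageZero_generic {k d : ℕ} {f : MvPolynomial (Fin n) F}
    (hf : f ∈ border (spsClass (RatFunc F) n k d)) :
    ∃ (m : ℕ) (G : Fin m → ExactTerm (RatFunc F') n), m ≤ k ∧
      (∀ i, (G i).WF ∧ (G i).ND ∧ (G i).Bdd d ∧ ∀ N, (G i).Cert N 1) ∧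
      (∀ i, (G i).FormsSat fun a => ∃ (c : RatFunc F') (b : Option (Fin n) → F'[X]), c ≠ 0 ∧
        (∀ o, a o = c * algebraMap F'[X] (RatFunc F') (b o)) ∧ (b none).coeff 0 ≠ 0) ∧
      StageComp (ratFuncMap (algebraMap F F'))
        (fun m => algebraMap F' (RatFunc F') (algebraMap (MvPolynomial (Fin n) F) F' (X m))) 0 G ∧
      (∀ i i', (G i).Q = (G i').Q) ∧
      EpsLim (∑ i, (G i).val)
        (algebraMap (MvPolynomial (Fin n) F') (FractionRing (MvPolynomial (Fin n) F'))
          (aeval (fun i : Fin n => (X i + C (algebraMap (MvPolynomial (Fin n) F) F' (X i)) :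
            MvPolynomial (Fin n) F')) (map (algebraMap F F') f))) := by
  obtain ⟨T, Ts, -, hnone, hsome, hfs⟩ := exists_shiftedForms (algebraMap F F')
    (fun m => algebraMap (MvPolynomial (Fin n) F) F' (X m)) hf
  have hreg := hreg_of_generic_shift (F := F) (F' := F') (id : Fin n → Fin n)
    Function.injective_id hnone hsome
  have h0 : ∀ i j, affForm (Ts i j) ≠ 0 → (Ts i j) none ≠ 0 := fun i j h =>
    none_ne_zero_of_regular (hreg i j h)
  obtain ⟨m, G, hm, hG, -, hshape, hsum⟩ := exists_stageZero_ofLiveTerm Ts h0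
  refine ⟨m, G, hm, hG, ?_, ?_, uniformQ_of_ofLiveTerm hshape, ?_⟩
  · intro i
    obtain ⟨i', hlive, hGi⟩ := hshape i
    rw [hGi]
    exact formsSat_ofLiveTerm _ hlive fun j => hreg i' j (affForm_ne_zero (hlive j))
  · exact stageComp_zero_of_ofLiveTerm hshape fun i' j => isPres_affForm_shift (hnone i' j) (hsome i' j)
  · rw [hsum]
    exact epsLim_algebraMap_of_isEpsApprox hfs

/-! ## §B The regular run -/

/-- ★ **The regular DiDIL run at the generic point.** `exists_didil_run` from the stage-0 family of
`exists_stageZero_generic` (`λ_0 = 1`, `B_0 = d`, `t_0 = 1`, certificate degree `N` free), with the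
two invariants carried to every stage `j ≤ r`: every term has `ε`-regular form lists
(`run_invariant_termwise` + `formsSat_didilStep`), and the stage has the companion invariant with
excess `min j 1` (`stageComp_run`).
[cite: DuttaDwivediSaxena2022, §3 proof of Thm. 3.2, base case and induction with hypotheses (1)–(3) (full version p0028 L745 – p0030 L812)] -/
theorem exists_regular_run [CharZero F'] (N : ℕ) {k d : ℕ} {f : MvPolynomial (Fin n) F}
    (hf : f ∈ border (spsClass (RatFunc F) n k d)) :
    ∃ (m r : ℕ) (Fam : ℕ → (Σ m' : ℕ, Fin m' → ExactTerm (RatFunc F') n)) (lamS : ℕ → RatFunc F')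
      (fr : ℕ → FractionRing (MvPolynomial (Fin n) F')) (Bs ts : ℕ → ℕ),
      m ≤ k ∧ r + 1 ≤ max m 1 ∧
      fr 0 = algebraMap (MvPolynomial (Fin n) F') (FractionRing (MvPolynomial (Fin n) F'))
          (aeval (fun i : Fin n => (X i + C (algebraMap (MvPolynomial (Fin n) F) F' (X i)) :
            MvPolynomial (Fin n) F')) (map (algebraMap F F') f)) ∧
      lamS 0 = 1 ∧ Bs 0 = d ∧ ts 0 = 1 ∧
      (∀ j, j < r → ∃ (m' : ℕ) (G' : Fin (m' + 1) → ExactTerm (RatFunc F') n) (i₀ : Fin (m' + 1))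
          (c : RatFunc F') (U : FractionRing (MvPolynomial (Fin n) (RatFunc F')))
          (u : FractionRing (MvPolynomial (Fin n) F')),
        Fam j = ⟨m' + 1, G'⟩ ∧ Fam (j + 1) = ⟨m', didilStep (euler (Fin n) (RatFunc F')) G' i₀⟩ ∧
        (G' i₀).ND ∧ c ≠ 0 ∧
        (G' i₀).val = algebraMap (RatFunc F') (FractionRing (MvPolynomial (Fin n) (RatFunc F'))) c * U ∧
        EpsLim U u ∧ u ≠ 0 ∧ lamS (j + 1) = lamS j * c ∧
        fr (j + 1) = eulerFrac (Fin n) F' (FractionRing (MvPolynomial (Fin n) F')) (fr j / u) ∧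
        EpsLim (algebraMap (RatFunc F') (FractionRing (MvPolynomial (Fin n) (RatFunc F')))
            (lamS j * c) * (∑ i, (G' i).val) / (G' i₀).val) (fr j / u) ∧
        Bs (j + 1) = 20 * Bs j ∧ ts (j + 1) = (4 * Bs j + 2) * N ^ 8 * ts j ^ 4) ∧
      (∀ j, j ≤ r → lamS j ≠ 0 ∧
        EpsLim (algebraMap (RatFunc F') (FractionRing (MvPolynomial (Fin n) (RatFunc F'))) (lamS j) *
          ∑ i, ((Fam j).2 i).val) (fr j) ∧
        ∀ i, ((Fam j).2 i).WF ∧ ((Fam j).2 i).Bdd (Bs j) ∧ ((Fam j).2 i).Cert N (ts j)) ∧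
      (∀ j, j ≤ r → ∀ i, ((Fam j).2 i).FormsSat fun a => ∃ (c : RatFunc F')
          (b : Option (Fin n) → F'[X]), c ≠ 0 ∧
        (∀ o, a o = c * algebraMap F'[X] (RatFunc F') (b o)) ∧ (b none).coeff 0 ≠ 0) ∧
      (∀ j, j ≤ r → StageComp (ratFuncMap (algebraMap F F'))
        (fun m => algebraMap F' (RatFunc F') (algebraMap (MvPolynomial (Fin n) F) F' (X m)))
          (min j 1) (Fam j).2) ∧
      (∀ j, j ≤ r → (Fam j).1 + j = m) ∧
      (∀ j, j ≤ r → ∀ i i', ((Fam j).2 i).Q = ((Fam j).2 i').Q) ∧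
      ((∃ T' : ExactTerm (RatFunc F') n, Fam r = ⟨1, fun _ => T'⟩) ∨ fr r = 0) := by
  obtain ⟨m, G, hm, hG, hregs, hcomp, huq, hlim⟩ := exists_stageZero_generic (F' := F') hf
  have h1 : EpsLim (algebraMap (RatFunc F') (FractionRing (MvPolynomial (Fin n) (RatFunc F'))) 1 *
      ∑ i, (G i).val)
      (algebraMap (MvPolynomial (Fin n) F') (FractionRing (MvPolynomial (Fin n) F'))
        (aeval (fun i : Fin n => (X i + C (algebraMap (MvPolynomial (Fin n) F) F' (X i)) :
          MvPolynomial (Fin n) F')) (map (algebraMap F F') f))) := by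
    rwa [map_one, one_mul]
  obtain ⟨r, Fam, lamS, fr, Bs, ts, hr, hFam0, hf0, hlam0, hBs0, hts0, hround, hinv, hend⟩ :=
    exists_didil_run N m G (fun i => (hG i).1) (fun i => (hG i).2.2.1) (fun i => (hG i).2.2.2 N)
      one_ne_zero h1
  have hstep : ∀ j, j < r → ∃ (m' : ℕ) (G' : Fin (m' + 1) → ExactTerm (RatFunc F') n)
      (i₀ : Fin (m' + 1)), Fam j = ⟨m' + 1, G'⟩ ∧
        Fam (j + 1) = ⟨m', didilStep (euler (Fin n) (RatFunc F')) G' i₀⟩ ∧ (G' i₀).ND := by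
    intro j hj
    obtain ⟨m', G', i₀, c, U, u, h1, h2, h3, -⟩ := hround j hj
    exact ⟨m', G', i₀, h1, h2, h3⟩
  have hstep' : ∀ j, j < r → ∃ (m' : ℕ) (G' : Fin (m' + 1) → ExactTerm (RatFunc F') n)
      (i₀ : Fin (m' + 1)), Fam j = ⟨m' + 1, G'⟩ ∧
        Fam (j + 1) = ⟨m', didilStep (euler (Fin n) (RatFunc F')) G' i₀⟩ := fun j hj => by
    obtain ⟨m', G', i₀, h1, h2, -⟩ := hstep j hj
    exact ⟨m', G', i₀, h1, h2⟩
  refine ⟨m, r, Fam, lamS, fr, Bs, ts, hm, hr, hf0, hlam0, hBs0, hts0, hround, hinv, ?_, ?_, ?_,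
    uniformQ_run hstep' (by rw [hFam0]; exact huq), hend⟩
  · refine run_invariant_termwise _ hstep (by rw [hFam0]; exact hregs) ?_
    intro m' G' i₀ h _ i
    exact formsSat_didilStep _ h i₀ i
  · exact stageComp_run hstep' (by rw [hFam0]; exact hcomp)
  · refine run_invariant (fun j S => S.1 + j = m) hstep (by rw [hFam0]; rfl) ?_
    intro j m' G' i₀ _ h _
    show m' + (j + 1) = m
    have h' : m' + 1 + j = m := h
    omega

/-! ## §C One round's divisor pair -/

/-- Nonvanishing transported along `u · D = N` in `F′(x)`. (folklore)
[cite: DuttaDwivediSaxena2022, §2 "Valuation" (full version p0015 L407–410)] -/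
theorem ne_zero_of_mul_limToFrac_eq {K : Type*} [Field K] {σ : Type*}
    {u : FractionRing (MvPolynomial σ K)} {N D : MvPolynomial σ K} (hu : u ≠ 0) (hD : D ≠ 0)
    (h : u * limToFrac K σ D = limToFrac K σ N) : N ≠ 0 := by
  rintro rfl
  rw [map_zero, mul_eq_zero] at h
  rcases h with h | h
  · exact hu h
  · exact hD ((map_eq_zero_iff _ (IsFractionRing.injective (MvPolynomial σ K) _)).mp h)

/-- ★ **One round's divisor pair** (Claim 3.5 (ii) "`t_{k−j,j}`" with its programs, Claim 3.6, and
the graded valuation `val(t) = e`). For a nondegenerate divisor `T_{i₀} = c·U` (`c ≠ 0`,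
`lim U = u ≠ 0`) of a well-formed companion stage of excess `e` over the generic point whose terms
are `Σ∧Σ`-certified below degree `N` with budget `t`, of size `≤ B < N`, with `ε`-regular form
lists, all within one parameter `S` (`2 ≤ S`, `n + 1, t, N, B ≤ S`): `u = tn/td` with `tn, td ≠ 0`,
`ldeg tn = ldeg td + e`, and programs / degrees of `tn, td` within `S^10`.
[cite: DuttaDwivediSaxena2022, §3 proof of Thm. 3.2, Claim 3.5 (ii) and "`d_{j+1} := d_j − v_{k−j,j} − 1`" (full version p0031 L815–834); Claim 3.3 (p0027 L724–744); Claim 3.6 (p0033 L880–890)] -/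
theorem round_pair [CharZero F'] {m' e N t B S : ℕ} {G' : Fin (m' + 1) → ExactTerm (RatFunc F') n}
    {i₀ : Fin (m' + 1)} (hWF : ∀ i, (G' i).WF) (hND : (G' i₀).ND)
    (hcert : ∀ i, (G' i).Cert N t) (hBd : ∀ i, (G' i).Bdd B) (hBN : B < N)
    (hregs : ∀ i, (G' i).FormsSat fun a => ∃ (c : RatFunc F') (b : Option (Fin n) → F'[X]), c ≠ 0 ∧
      (∀ o, a o = c * algebraMap F'[X] (RatFunc F') (b o)) ∧ (b none).coeff 0 ≠ 0)
    (hcomp : StageComp (ratFuncMap (algebraMap F F'))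
      (fun m => algebraMap F' (RatFunc F') (algebraMap (MvPolynomial (Fin n) F) F' (X m))) e G')
    (hS : 2 ≤ S) (hn : n + 1 ≤ S) (ht : t ≤ S) (hNS : N ≤ S) (hBS : B ≤ S)
    {c : RatFunc F'} (hc : c ≠ 0) {U : FractionRing (MvPolynomial (Fin n) (RatFunc F'))}
    {u : FractionRing (MvPolynomial (Fin n) F')}
    (hval : (G' i₀).val =
      algebraMap (RatFunc F') (FractionRing (MvPolynomial (Fin n) (RatFunc F'))) c * U)
    (hU : EpsLim U u) (hu : u ≠ 0) :
    ∃ tn td : MvPolynomial (Fin n) F', tn ≠ 0 ∧ td ≠ 0 ∧ ldeg tn = ldeg td + e ∧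
      u = limToFrac F' (Fin n) tn / limToFrac F' (Fin n) td ∧
      UABPComputes (S ^ 10) tn ∧ UABPComputes (S ^ 10) td ∧
      tn.totalDegree ≤ S ^ 10 ∧ td.totalDegree ≤ S ^ 10 := by
  have hcL : algebraMap (RatFunc F') (FractionRing (MvPolynomial (Fin n) (RatFunc F'))) c ≠ 0 :=
    (map_ne_zero _).mpr hc
  -- `c⁻¹ · T_{i₀} = U → u`
  have hT : EpsLim (algebraMap (RatFunc F') (FractionRing (MvPolynomial (Fin n) (RatFunc F'))) c⁻¹ *
      (G' i₀).val) u := by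
    rw [hval, map_inv₀, ← mul_assoc, inv_mul_cancel₀ hcL, one_mul]
    exact hU
  obtain ⟨tn, td, htd, hf, hPn, hPd, hdn, hdd⟩ :=
    ExactTerm.uabp_residue_scaled_le_of_formsSat (hWF i₀) (hcert i₀) (hBd i₀) hBN (hregs i₀)
      hS hn ht hNS hBS (inv_ne_zero hc) hT
  have htn : tn ≠ 0 := ne_zero_of_mul_limToFrac_eq hu htd hf
  -- the graded valuation from the companion invariant, transported to E3's pair
  obtain ⟨tn', td', htn', htd', hf', hl'⟩ :=
    exists_divisor_limit_ldeg (IsFractionRing.injective (MvPolynomial (Fin n) F) F') hWF hND hcomp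
      hval hU hu
  have hcross : tn * td' = tn' * td := by
    apply IsFractionRing.injective (MvPolynomial (Fin n) F') (FractionRing (MvPolynomial (Fin n) F'))
    show limToFrac F' (Fin n) (tn * td') = limToFrac F' (Fin n) (tn' * td)
    rw [map_mul, map_mul, ← hf, ← hf']
    ring
  have hl := ldeg_add_eq_of_cross htn htd htn' htd' hcross
  have htdL : limToFrac F' (Fin n) td ≠ 0 :=
    (map_ne_zero_iff _ (IsFractionRing.injective (MvPolynomial (Fin n) F') _)).mpr htd
  refine ⟨tn, td, htn, htd, by omega, ?_, hPn, hPd, hdn, hdd⟩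
  rw [eq_div_iff htdL, hf]

/-! ## §D The end pair -/

/-- ★ **The end pair** (Claim 3.3 at the last stage, "`f_{k−1} ∈ ABP/ABP`"): the last scaled term
`λ · T` (one regular, certified exact term left) has the limit `N₀/D₀` with programs and degrees
within `S^10`.
[cite: DuttaDwivediSaxena2022, Claim 3.3 with proof (full version p0027 L724–744); §3 end of the DiDIL induction (p0033 L891 – p0034 L897)] -/
theorem end_pair [CharZero F'] {N t B S : ℕ} {T' : ExactTerm (RatFunc F') n} (hWF : T'.WF)
    (hcert : T'.Cert N t) (hBd : T'.Bdd B) (hBN : B < N)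
    (hregs : T'.FormsSat fun a => ∃ (c : RatFunc F') (b : Option (Fin n) → F'[X]), c ≠ 0 ∧
      (∀ o, a o = c * algebraMap F'[X] (RatFunc F') (b o)) ∧ (b none).coeff 0 ≠ 0)
    (hS : 2 ≤ S) (hn : n + 1 ≤ S) (ht : t ≤ S) (hNS : N ≤ S) (hBS : B ≤ S)
    {lam : RatFunc F'} (hlam : lam ≠ 0) {fr : FractionRing (MvPolynomial (Fin n) F')}
    (h : EpsLim (algebraMap (RatFunc F') (FractionRing (MvPolynomial (Fin n) (RatFunc F'))) lam *
      ∑ i : Fin 1, ((fun _ => T') i).val) fr) :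
    ∃ N₀ D₀ : MvPolynomial (Fin n) F',
      fr = limToFrac F' (Fin n) N₀ / limToFrac F' (Fin n) D₀ ∧ D₀ ≠ 0 ∧
      UABPComputes (S ^ 10) N₀ ∧ UABPComputes (S ^ 10) D₀ ∧
      N₀.totalDegree ≤ S ^ 10 ∧ D₀.totalDegree ≤ S ^ 10 := by
  rw [Fin.sum_univ_one] at h
  obtain ⟨N₀, D₀, hD, hf, hPn, hPd, hdn, hdd⟩ :=
    ExactTerm.uabp_residue_scaled_le_of_formsSat hWF hcert hBd hBN hregs hS hn ht hNS hBS hlam h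
  have hDL : limToFrac F' (Fin n) D₀ ≠ 0 :=
    (map_ne_zero_iff _ (IsFractionRing.injective (MvPolynomial (Fin n) F') _)).mpr hD
  exact ⟨N₀, D₀, by rw [eq_div_iff hDL, hf], hD, hPn, hPd, hdn, hdd⟩

/-- The end pair in the degenerate case `f_r = 0 = 0/1` (every remaining term degenerate, or no term).
[cite: DuttaDwivediSaxena2022, §3 end of the DiDIL induction (full version p0033 L891 – p0034 L897)] -/
theorem end_pair_zero {S : ℕ} (hS : 2 ≤ S) {fr : FractionRing (MvPolynomial (Fin n) F')} (h : fr = 0) :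
    ∃ N₀ D₀ : MvPolynomial (Fin n) F',
      fr = limToFrac F' (Fin n) N₀ / limToFrac F' (Fin n) D₀ ∧ D₀ ≠ 0 ∧
      UABPComputes S N₀ ∧ UABPComputes S D₀ ∧ N₀.totalDegree ≤ S ∧ D₀.totalDegree ≤ S := by
  refine ⟨0, 1, by rw [h, map_zero, zero_div], one_ne_zero,
    (UABPComputesLen.zero hS 0).uabpComputes, ?_, by simp, by simp⟩
  have h1 := (UABPComputesLen.of_C (n := n) hS (1 : F')).uabpComputes
  rwa [C_1] at h1


/-! ## §E Part 2: the residue chain, composed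

The Claim-3.8 pairs `(Nw_j, ew_j)` — "`(f_j/t_{k−j,j})|_{z=0} ∈ ARO/ARO`" WITH PROGRAMS — are
`exists_sliceZero_programs_le` of `DDS21SliceZeroPrograms.lean` (t21 g13, lead-np RULINGS
(166)/(167)), applied at every round to the stage family of the run (uniform `𝒬`, companion
invariant, `ε`-regular forms, towers within the stage parameter). -/

/-- ★★ **The residue chain at the generic point, composed** (per instance; general fraction field
`F′ ⊇ F[y]`). From `f ∈ \overline{Σ^{[k]}Π^{[d]}Σ}` within budget `s`: `r ≤ k − 1` rounds, residues
`fres` with `fres 0 = f^φ(x + y)` and `fres (j+1) = E(fres j / (tn_j/td_j))`, divisor pairs with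
`ldeg tn_j = ldeg td_j + [j ≥ 1]`, Claim-3.8 pairs `GradeZero (fres j/(tn_j/td_j)) (Nw_j/ew_j)`
(`exists_sliceZero_programs_le`), the end pair `fres r = N₀/D₀`, all programs and degrees within
`(s^(90·7^(k−1)))^25`.
[cite: DuttaDwivediSaxena2022, §3 proof of Thm. 3.2 (full version p0028 L745 – p0036 L964): Claims 3.3–3.6, 3.8] -/
theorem exists_residueChain [CharZero F'] {k d s : ℕ}
    {f : MvPolynomial (Fin n) F} (hk : 1 ≤ k) (hks : k ≤ s) (hds : d ≤ s) (hns : n ≤ s)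
    (hs : 2 ≤ s) (hf : f ∈ border (spsClass (RatFunc F) n k d)) :
    ∃ (r : ℕ) (fres : ℕ → FractionRing (MvPolynomial (Fin n) F'))
      (tn td Nw ew : ℕ → MvPolynomial (Fin n) F') (N₀ D₀ : MvPolynomial (Fin n) F'),
      r + 1 ≤ k ∧
      fres 0 = algebraMap (MvPolynomial (Fin n) F') (FractionRing (MvPolynomial (Fin n) F'))
          (aeval (fun i : Fin n => (X i + C (algebraMap (MvPolynomial (Fin n) F) F' (X i)) :
            MvPolynomial (Fin n) F')) (map (algebraMap F F') f)) ∧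
      (∀ j < r, fres (j + 1) = eulerFrac (Fin n) F' (FractionRing (MvPolynomial (Fin n) F'))
        (fres j / (algebraMap (MvPolynomial (Fin n) F') (FractionRing (MvPolynomial (Fin n) F')) (tn j) /
          algebraMap (MvPolynomial (Fin n) F') (FractionRing (MvPolynomial (Fin n) F')) (td j)))) ∧
      (∀ j < r, tn j ≠ 0 ∧ td j ≠ 0 ∧ ldeg (tn j) = ldeg (td j) + min j 1 ∧
        GradeZero (fres j / (algebraMap (MvPolynomial (Fin n) F') (FractionRing (MvPolynomial (Fin n) F')) (tn j) /
          algebraMap (MvPolynomial (Fin n) F') (FractionRing (MvPolynomial (Fin n) F')) (td j)))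
          (algebraMap (MvPolynomial (Fin n) F') (FractionRing (MvPolynomial (Fin n) F')) (Nw j) /
            algebraMap (MvPolynomial (Fin n) F') (FractionRing (MvPolynomial (Fin n) F')) (ew j)) ∧
        ew j ≠ 0 ∧
        UABPComputes ((s ^ (90 * 7 ^ (k - 1))) ^ 25) (tn j) ∧
        UABPComputes ((s ^ (90 * 7 ^ (k - 1))) ^ 25) (td j) ∧
        UABPComputes ((s ^ (90 * 7 ^ (k - 1))) ^ 25) (Nw j) ∧
        UABPComputes ((s ^ (90 * 7 ^ (k - 1))) ^ 25) (ew j) ∧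
        (tn j).totalDegree ≤ (s ^ (90 * 7 ^ (k - 1))) ^ 25 ∧
        (td j).totalDegree ≤ (s ^ (90 * 7 ^ (k - 1))) ^ 25) ∧
      fres r = algebraMap (MvPolynomial (Fin n) F') (FractionRing (MvPolynomial (Fin n) F')) N₀ /
        algebraMap (MvPolynomial (Fin n) F') (FractionRing (MvPolynomial (Fin n) F')) D₀ ∧ D₀ ≠ 0 ∧
      UABPComputes ((s ^ (90 * 7 ^ (k - 1))) ^ 25) N₀ ∧
      UABPComputes ((s ^ (90 * 7 ^ (k - 1))) ^ 25) D₀ ∧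
      N₀.totalDegree ≤ (s ^ (90 * 7 ^ (k - 1))) ^ 25 ∧
      D₀.totalDegree ≤ (s ^ (90 * 7 ^ (k - 1))) ^ 25 := by
  obtain ⟨h2S, hnS, hNS, -, -⟩ := transcriptBudget (n := n) (d := d) hk hds hns hs
  have hs1 : 1 ≤ s := by omega
  have hsS : s ≤ s ^ (90 * 7 ^ (k - 1)) := by
    calc s = s ^ 1 := (pow_one s).symm
      _ ≤ s ^ (90 * 7 ^ (k - 1)) :=
        Nat.pow_le_pow_right hs1 (Nat.one_le_iff_ne_zero.mpr (by positivity))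
  have hS1 : 0 < s ^ (90 * 7 ^ (k - 1)) := by positivity
  have h10 : (s ^ (90 * 7 ^ (k - 1))) ^ 10 ≤ (s ^ (90 * 7 ^ (k - 1))) ^ 25 :=
    Nat.pow_le_pow_right hS1 (by omega)
  have hκ : (s ^ (90 * 7 ^ (k - 1))) ^ 15 ≤ (s ^ (90 * 7 ^ (k - 1))) ^ 25 :=
    Nat.pow_le_pow_right hS1 (by omega)
  have h2σ : 2 ≤ (s ^ (90 * 7 ^ (k - 1))) ^ 25 :=
    h2S.trans (le_trans (le_of_eq (pow_one _).symm) (Nat.pow_le_pow_right hS1 (by omega)))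
  -- the regular run with certificate degree `N := 20^(k−1)·d + 1`
  obtain ⟨m, r, Fam, lamS, fr, Bs, ts, hm, hr, hf0, hlam0, hBs0, hts0, hround, hinv, hregs, hcomps,
    hsize, huq, hend⟩ := exists_regular_run (F' := F') (20 ^ (k - 1) * d + 1) hf
  have hrk : r < k := by
    rcases Nat.lt_or_ge m 1 with hm1 | hm1
    · rw [max_eq_right (by omega)] at hr; omega
    · rw [max_eq_left hm1] at hr; omega
  have htow := run_towers_le hs hds hrk (certDegree_le hs hds) Bs ts hBs0 hts0
    (fun j hj => by
      obtain ⟨_, _, _, _, _, _, -, -, -, -, -, -, -, -, -, -, h, -⟩ := hround j hj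
      exact h)
    (fun j hj => by
      obtain ⟨_, _, _, _, _, _, -, -, -, -, -, -, -, -, -, -, -, h⟩ := hround j hj
      exact h)
  -- per-round data
  have hR : ∀ j, ∃ (tn td Nw ew : MvPolynomial (Fin n) F'), j < r →
      (tn ≠ 0 ∧ td ≠ 0 ∧ ldeg tn = ldeg td + min j 1 ∧
        fr (j + 1) = eulerFrac (Fin n) F' (FractionRing (MvPolynomial (Fin n) F'))
          (fr j / (limToFrac F' (Fin n) tn / limToFrac F' (Fin n) td)) ∧
        GradeZero (fr j / (limToFrac F' (Fin n) tn / limToFrac F' (Fin n) td))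
          (limToFrac F' (Fin n) Nw / limToFrac F' (Fin n) ew) ∧ ew ≠ 0 ∧
        UABPComputes ((s ^ (90 * 7 ^ (k - 1))) ^ 25) tn ∧
        UABPComputes ((s ^ (90 * 7 ^ (k - 1))) ^ 25) td ∧
        UABPComputes ((s ^ (90 * 7 ^ (k - 1))) ^ 25) Nw ∧
        UABPComputes ((s ^ (90 * 7 ^ (k - 1))) ^ 25) ew ∧
        tn.totalDegree ≤ (s ^ (90 * 7 ^ (k - 1))) ^ 25 ∧
        td.totalDegree ≤ (s ^ (90 * 7 ^ (k - 1))) ^ 25) := by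
    intro j
    by_cases hj : j < r
    · obtain ⟨m', G', i₀, c, U, u, hFj, -, hND, hc, hval, hU, hu, -, hfrj, hY, -, -⟩ := hround j hj
      have hinvj := hinv j hj.le
      have hregj := hregs j hj.le
      have hcompj := hcomps j hj.le
      have hsizej := hsize j hj.le
      have huqj := huq j hj.le
      rw [hFj] at hinvj hregj hcompj hsizej huqj
      obtain ⟨hBsj, htsj, hBN⟩ := htow j hj.le
      have hm' : m' + 1 ≤ s ^ (90 * 7 ^ (k - 1)) := by
        have : m' + 1 + j = m := hsizej
        exact le_trans (by omega) hsS
      obtain ⟨tn, td, htn, htd, hl, hu', hPn, hPd, hdn, hdd⟩ :=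
        round_pair (fun i => (hinvj.2.2 i).1) hND (fun i => (hinvj.2.2 i).2.2)
          (fun i => (hinvj.2.2 i).2.1) hBN hregj hcompj h2S hnS htsj hNS hBsj hc hval hU hu
      obtain ⟨Nw, ew, hew, hgz, hPNw, hPew, -, -⟩ :=
        exists_sliceZero_programs_le (IsFractionRing.injective (MvPolynomial (Fin n) F) F')
          (fun i => (hinvj.2.2 i).1) hND hcompj (fun i => huqj i i₀) (fun i => (hinvj.2.2 i).2.2)
          (fun i => (hinvj.2.2 i).2.1) hBN h2S hnS htsj hBsj hm' (lamS j * c) hY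
      rw [hu'] at hfrj hgz
      exact ⟨tn, td, Nw, ew, fun _ => ⟨htn, htd, hl, hfrj, hgz, hew, hPn.mono h10, hPd.mono h10,
        hPNw.mono hκ, hPew.mono hκ, hdn.trans h10, hdd.trans h10⟩⟩
    · exact ⟨0, 0, 0, 0, fun h => absurd h hj⟩
  choose tn td Nw ew hP using hR
  -- the end pair
  have hE : ∃ N₀ D₀ : MvPolynomial (Fin n) F',
      fr r = limToFrac F' (Fin n) N₀ / limToFrac F' (Fin n) D₀ ∧ D₀ ≠ 0 ∧
      UABPComputes ((s ^ (90 * 7 ^ (k - 1))) ^ 25) N₀ ∧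
      UABPComputes ((s ^ (90 * 7 ^ (k - 1))) ^ 25) D₀ ∧
      N₀.totalDegree ≤ (s ^ (90 * 7 ^ (k - 1))) ^ 25 ∧
      D₀.totalDegree ≤ (s ^ (90 * 7 ^ (k - 1))) ^ 25 := by
    rcases hend with ⟨T', hFr⟩ | hzero
    · have hinvr := hinv r le_rfl
      have hregr := hregs r le_rfl
      rw [hFr] at hinvr hregr
      obtain ⟨hBsr, htsr, hBNr⟩ := htow r le_rfl
      obtain ⟨N₀, D₀, h1, h2, h3, h4, h5, h6⟩ :=
        end_pair (hinvr.2.2 0).1 (hinvr.2.2 0).2.2 (hinvr.2.2 0).2.1 hBNr (hregr 0) h2S hnS htsr hNS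
          hBsr hinvr.1 hinvr.2.1
      exact ⟨N₀, D₀, h1, h2, h3.mono h10, h4.mono h10, h5.trans h10, h6.trans h10⟩
    · exact end_pair_zero h2σ hzero
  obtain ⟨N₀, D₀, hE1, hE2, hE3, hE4, hE5, hE6⟩ := hE
  refine ⟨r, fr, tn, td, Nw, ew, N₀, D₀, by omega, hf0, fun j hj => (hP j hj).2.2.2.1,
    fun j hj => ⟨(hP j hj).1, (hP j hj).2.1, (hP j hj).2.2.1, (hP j hj).2.2.2.2.1,
      (hP j hj).2.2.2.2.2.1, (hP j hj).2.2.2.2.2.2.1, (hP j hj).2.2.2.2.2.2.2.1,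
      (hP j hj).2.2.2.2.2.2.2.2.1, (hP j hj).2.2.2.2.2.2.2.2.2.1, (hP j hj).2.2.2.2.2.2.2.2.2.2.1,
      (hP j hj).2.2.2.2.2.2.2.2.2.2.2⟩, hE1, hE2, hE3, hE4, hE5, hE6⟩

end Generic

/-! ## §F `residueChain_exists` over the field of record `F′ = Frac F[y]`, from the slice programs -/

section OfRecord

/-- ★★★ **`residueChain_exists`** — the ONE hypothesis of `DDS2021_thm_3_2_of_residueChain`
(`DDS21TranscriptInstantiation.lean`, p1 g10), binder VERBATIM, over the field of record
`F′ = Frac F[y_1,…,y_n]` and the generic point `α = y`, with `σ := (s^(90·7^(k−1)))^25` and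
`c₀ := (90·25+1)·7 = 15757` (budget arithmetic of `DDS21CertTowerBudget.lean`): for every
`f ∈ \overline{Σ^{[k]}Π^{[d]}Σ}` within budget `s` over a field of characteristic `0`, the DiDIL
residue chain with divisor pairs, Claim-3.8 pairs and end pair, all ABP-computed within `σ`.
Hence `DDS2021_thm_3_2_holds := DDS2021_thm_3_2_of_residueChain residueChain_exists`
(`AC/DDS21Thm32Holds.lean`, p1 g10, lead-np RULING (164)(e)).
[cite: DuttaDwivediSaxena2022, Thm. 3.2 (full version p0026 L710–717) and its proof §3 (p0026 L713 – p0036 L964)] -/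
theorem residueChain_exists :
    ∃ c₀ : ℕ, ∀ (F : Type) [Field F] [CharZero F] (n k d s : ℕ) (f : MvPolynomial (Fin n) F),
      1 ≤ k → k ≤ s → d ≤ s → n ≤ s → 2 ≤ s →
        f ∈ border (spsClass (RatFunc F) n k d) →
          ∃ (r σ : ℕ) (α : Fin n → FractionRing (MvPolynomial (Fin n) F))
            (fres : ℕ → FractionRing (MvPolynomial (Fin n) (FractionRing (MvPolynomial (Fin n) F))))
            (tn td Nw ew : ℕ → MvPolynomial (Fin n) (FractionRing (MvPolynomial (Fin n) F)))
            (N₀ D₀ : MvPolynomial (Fin n) (FractionRing (MvPolynomial (Fin n) F))),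
            r + 1 ≤ k ∧ (σ + 1) ^ 7 ≤ s ^ (c₀ * 7 ^ (k - 1)) ∧ 2 ≤ σ ∧
            (map (algebraMap F (FractionRing (MvPolynomial (Fin n) F))) f).totalDegree + k ≤ σ ∧
            fres 0 = algebraMap (MvPolynomial (Fin n) (FractionRing (MvPolynomial (Fin n) F))) (FractionRing (MvPolynomial (Fin n) (FractionRing (MvPolynomial (Fin n) F)))) (aeval (fun i : Fin n => (X i + C (α i) :
              MvPolynomial (Fin n) (FractionRing (MvPolynomial (Fin n) F))))
                (map (algebraMap F (FractionRing (MvPolynomial (Fin n) F))) f)) ∧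
            (∀ j < r, fres (j + 1) = eulerFrac (Fin n) (FractionRing (MvPolynomial (Fin n) F)) _
              (fres j / (algebraMap (MvPolynomial (Fin n) (FractionRing (MvPolynomial (Fin n) F))) (FractionRing (MvPolynomial (Fin n) (FractionRing (MvPolynomial (Fin n) F)))) (tn j) / algebraMap (MvPolynomial (Fin n) (FractionRing (MvPolynomial (Fin n) F))) (FractionRing (MvPolynomial (Fin n) (FractionRing (MvPolynomial (Fin n) F)))) (td j)))) ∧
            (∀ j < r, tn j ≠ 0 ∧ td j ≠ 0 ∧ ldeg (tn j) = ldeg (td j) + min j 1 ∧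
              GradeZero (fres j / (algebraMap (MvPolynomial (Fin n) (FractionRing (MvPolynomial (Fin n) F))) (FractionRing (MvPolynomial (Fin n) (FractionRing (MvPolynomial (Fin n) F)))) (tn j) / algebraMap (MvPolynomial (Fin n) (FractionRing (MvPolynomial (Fin n) F))) (FractionRing (MvPolynomial (Fin n) (FractionRing (MvPolynomial (Fin n) F)))) (td j)))
                (algebraMap (MvPolynomial (Fin n) (FractionRing (MvPolynomial (Fin n) F))) (FractionRing (MvPolynomial (Fin n) (FractionRing (MvPolynomial (Fin n) F)))) (Nw j) / algebraMap (MvPolynomial (Fin n) (FractionRing (MvPolynomial (Fin n) F))) (FractionRing (MvPolynomial (Fin n) (FractionRing (MvPolynomial (Fin n) F)))) (ew j)) ∧ ew j ≠ 0 ∧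
              UABPComputes σ (tn j) ∧ UABPComputes σ (td j) ∧ UABPComputes σ (Nw j) ∧
              UABPComputes σ (ew j) ∧ (tn j).totalDegree ≤ σ ∧ (td j).totalDegree ≤ σ) ∧
            fres r = algebraMap (MvPolynomial (Fin n) (FractionRing (MvPolynomial (Fin n) F))) (FractionRing (MvPolynomial (Fin n) (FractionRing (MvPolynomial (Fin n) F)))) N₀ / algebraMap (MvPolynomial (Fin n) (FractionRing (MvPolynomial (Fin n) F))) (FractionRing (MvPolynomial (Fin n) (FractionRing (MvPolynomial (Fin n) F)))) D₀ ∧ D₀ ≠ 0 ∧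
            UABPComputes σ N₀ ∧ UABPComputes σ D₀ ∧ N₀.totalDegree ≤ σ ∧ D₀.totalDegree ≤ σ := by
  refine ⟨(90 * 25 + 1) * 7, fun F _ _ n k d s f hk hks hds hns hs hf => ?_⟩
  haveI : CharZero (FractionRing (MvPolynomial (Fin n) F)) :=
    charZero_of_injective_algebraMap
      ((IsFractionRing.injective (MvPolynomial (Fin n) F) (FractionRing (MvPolynomial (Fin n) F))).comp
        (C_injective (Fin n) F) : Function.Injective
          (algebraMap F (FractionRing (MvPolynomial (Fin n) F))))
  obtain ⟨r, fres, tn, td, Nw, ew, N₀, D₀, hrk, h0, hstep, hround, hend, hD₀, hN₀P, hD₀P, hN₀d, hD₀d⟩ :=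
    exists_residueChain (F' := FractionRing (MvPolynomial (Fin n) F)) hk hks hds hns hs hf
  have hs1 : 1 ≤ s := by omega
  have hσ : (s ^ (90 * 7 ^ (k - 1))) ^ 25 ≤ s ^ (90 * 25 * 7 ^ (k - 1)) :=
    le_of_eq (by rw [← pow_mul]; ring_nf)
  have hσ7 := succ_pow_le_stagePow hs hσ 7
  have hS1 : 0 < s ^ (90 * 7 ^ (k - 1)) := by positivity
  have h2S : 2 ≤ s ^ (90 * 7 ^ (k - 1)) := (transcriptBudget (n := n) (d := d) hk hds hns hs).1
  have hSσ : s ^ (90 * 7 ^ (k - 1)) ≤ (s ^ (90 * 7 ^ (k - 1))) ^ 25 :=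
    le_trans (le_of_eq (pow_one _).symm) (Nat.pow_le_pow_right hS1 (by omega))
  have hdeg : (map (algebraMap F (FractionRing (MvPolynomial (Fin n) F))) f).totalDegree + k ≤
      (s ^ (90 * 7 ^ (k - 1))) ^ 25 := by
    have hfd : (map (algebraMap F (FractionRing (MvPolynomial (Fin n) F))) f).totalDegree ≤ d :=
      (totalDegree_map_le_totalDegree _ f).trans (totalDegree_le_of_mem_border_spsClass hf)
    have h2 : d + k ≤ s ^ 2 := by nlinarith
    have h3 : s ^ 2 ≤ s ^ (90 * 7 ^ (k - 1)) :=
      Nat.pow_le_pow_right hs1 (le_trans (by norm_num)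
        (Nat.mul_le_mul_left 90 (Nat.one_le_pow _ _ (by norm_num))))
    omega
  exact ⟨r, (s ^ (90 * 7 ^ (k - 1))) ^ 25,
    fun i => algebraMap (MvPolynomial (Fin n) F) (FractionRing (MvPolynomial (Fin n) F)) (X i),
    fres, tn, td, Nw, ew, N₀, D₀, hrk, hσ7, h2S.trans hSσ, hdeg, h0, hstep, hround, hend, hD₀, hN₀P,
    hD₀P, hN₀d, hD₀d⟩

end OfRecord

end DDS2021

end Literature.Computability.AlgebraicComplexity

end
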